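import Mathlib.Combinatorics.SetFamily.Compression.Down
import Mathlib.Tactic
import HarnessLib
import HarnessLib.Audit.Tags
import Summits.CriticalPhenomena.PercolationContinuityZ3.Theorems.PercNearOneGluingNoHeavyLowerTailSahiRainbowTwoColourSmallThree
import Summits.CriticalPhenomena.PercolationContinuityZ3.Theorems.PercNearOneGluingNoHeavyLowerTailSahiRainbowTwoColourDeficitFinal

/-!
# The two-colouring statement for FOUR antipodal pairs; `SmallTwoColourMeets`, `TwoColourMeets` and the RAINBOW LEMMA proved

Support file (seat `prim-masterthm-p1`, gen 42; `--supports stmt-CriticalPhenomena-4575`).  No `sorry`, standard axioms.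

SETTING (`…SahiRainbowTwoColour`): `Z = X ⊔ Y ⊆ 2^G` complement-closed, `L = monoMeets X Y`.

THIS FILE.
* `four_le_card_monoMeets_eight`: `#Z = 8 ⟹ 4 ≤ #L`, by induction on `#G`: a point with no doubled member is projected
  away; otherwise take three points of `G`: if one of them is a twin point (`#D_y ≤ 2 · #twins_y`) then either `#D_y = 2` and
  the projected configuration has six members (`three_le_card_monoMeets_six`) plus one twin, or `#D_y = 4` and the two twins
  with their lifts are four colours; if all three are deficit, the local structure theorem (`deficit_cases`) makes them three
  S₂-points (S₁-points being excluded by `…DeficitMixK` / `…DeficitS1`), so the three singletons are colours.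
* **`smallTwoColourMeets : SmallTwoColourMeets α`** (the cases `#Z ∈ {6, 8}`), hence — with `sparseTwinPoint` of
  `…TwoColourDeficitFinal` — the UNCONDITIONAL theorems **`twoColourMeets : TwoColourMeets α`** (gen 40/41's three-family
  inequality M3♯ = `ThreeFamilyTwin`, `threeFamilyTwin`), **`rainbowStrict : RainbowStrict α`** and
  **`rainbowMeetCojoin : RainbowMeetCojoin α` — THE RAINBOW LEMMA** (gen 33: a complement-free family of `N` subsets of `G` has at
  least `N` distinct sets among `∅`, the pairwise meets and the complemented pairwise joins of distinct members).
HONEST FRAMING: all statements in this file are now kernel theorems with the standard axioms. [this work]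
-/

namespace Summit.CriticalPhenomena.PercolationContinuityZ3.Theorems.SahiColouredDaykin

open Finset
open scoped FinsetFamily

variable {α : Type*} [DecidableEq α]

section Small4

variable {X Y : Finset (Finset α)} {G : Finset α}

/-- The doubled members are at most half of the family. [this work] -/
theorem two_mul_card_bothLifts_le (Z : Finset (Finset α)) (y : α) : 2 * #(bothLifts Z y) ≤ #Z := by
  have h1 := card_image_erase_add_card_bothLifts Z y
  have h2 : #(bothLifts Z y) ≤ #(Z.image fun s => s.erase y) := card_le_card (bothLifts_subset_image_erase Z y)
  omega

/-- Twins are counted twice in `#L`: `2 · #twins_y ≤ #L`. [this work] -/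
theorem two_mul_card_twins_le (X Y : Finset (Finset α)) (y : α) :
    2 * #(bothLifts (monoMeets X Y) y) ≤ #(monoMeets X Y) :=
  two_mul_card_bothLifts_le _ _

/-- The projected configuration bounds the colours from below: `#(monoMeets X' Y') + #twins_y ≤ #L`. [this work] -/
theorem card_proj_add_twins_le (X Y : Finset (Finset α)) (y : α) :
    #(monoMeets (X.image fun s => s.erase y) ((Y.image fun s => s.erase y) \ X.image fun s => s.erase y)) +
      #(bothLifts (monoMeets X Y) y) ≤ #(monoMeets X Y) := by
  have h1 := card_image_erase_add_card_bothLifts (monoMeets X Y) y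
  have h2 := card_le_card (monoMeets_proj_subset X Y y)
  omega

/-- Three deficit points give the three singleton colours (or are contradictory): `4 ≤ #L`. [this work] -/
theorem four_le_of_three_deficit (hXY : Disjoint X Y) (hZG : ∀ z ∈ X ∪ Y, z ⊆ G) (hcc : ∀ z ∈ X ∪ Y, G \ z ∈ X ∪ Y)
    {y₁ y₂ y₃ : α} (hy₁ : y₁ ∈ G) (hy₂ : y₂ ∈ G) (hy₃ : y₃ ∈ G) (h12 : y₁ ≠ y₂) (h13 : y₁ ≠ y₃) (h23 : y₂ ≠ y₃)
    (hd : ∀ y ∈ ({y₁, y₂, y₃} : Finset α), 0 < #(bothLifts (X ∪ Y) y) ∧ #(bothLifts (X ∪ Y) y) < 6 ∧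
      2 * #(bothLifts (monoMeets X Y) y) < #(bothLifts (X ∪ Y) y)) : 4 ≤ #(monoMeets X Y) := by
  have ne : ∀ {y y' : α}, y ≠ y' → y' ∈ G → (G.erase y).Nonempty := fun h h' => ⟨_, mem_erase.2 ⟨h.symm, h'⟩⟩
  obtain ⟨hp₁, hl₁, hd₁⟩ := hd y₁ (by simp)
  obtain ⟨hp₂, hl₂, hd₂⟩ := hd y₂ (by simp)
  obtain ⟨hp₃, hl₃, hd₃⟩ := hd y₃ (by simp)
  have c₁ := deficit_cases hXY hZG hcc hy₁ (ne h12 hy₂) hp₁ hl₁ hd₁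
  have c₂ := deficit_cases hXY hZG hcc hy₂ (ne h12.symm hy₁) hp₂ hl₂ hd₂
  have c₃ := deficit_cases hXY hZG hcc hy₃ (ne h13.symm hy₁) hp₃ hl₃ hd₃
  have g12 : ∃ t ∈ G, t ≠ y₁ ∧ t ≠ y₂ := ⟨y₃, hy₃, h13.symm, h23.symm⟩
  have g13 : ∃ t ∈ G, t ≠ y₁ ∧ t ≠ y₃ := ⟨y₂, hy₂, h12.symm, h23⟩
  have mix : ∀ {y y' : α} {P Q : Finset α}, S1At X Y G y P Q → y ≠ y' → (∃ t ∈ G, t ≠ y ∧ t ≠ y') →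
      (((∃ A A' B B', DAt X Y G y' A A' B B') ∨ (∃ C C', Q3At X Y G y' C C')) ∨ (∃ C C', Q3At Y X G y' C C')) →
      False := by
    intro y y' P Q h hyy' hg p
    rcases p with (⟨A, A', B, B', h'⟩ | ⟨C, C', h'⟩) | ⟨C, C', h'⟩
    · exact h.false_of_DAt hXY h' hyy' hg
    · exact h.false_of_Q3At hXY h' hyy' hg
    · exact h.false_of_Q3At' hXY h' hyy' hg
  -- singleton colours at S₂-points
  have sing : ∀ {y : α}, (((∃ A A' B B', DAt X Y G y A A' B B') ∨ (∃ C C', Q3At X Y G y C C')) ∨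
      (∃ C C', Q3At Y X G y C C')) → ({y} : Finset α) ∈ monoMeets X Y := by
    intro y p
    rcases p with (⟨A, A', B, B', h⟩ | ⟨C, C', h⟩) | ⟨C, C', h⟩
    · exact h.singleton_mem
    · exact h.singleton_mem
    · have := h.singleton_mem; rwa [monoMeets_comm] at this
  rcases c₁ with ⟨P₁, Q₁, s₁⟩ | t₁
  · rcases c₂ with ⟨P₂, Q₂, s₂⟩ | t₂
    · rcases c₃ with ⟨P₃, Q₃, s₃⟩ | t₃
      · exact (s₁.false_of_three hXY s₂ s₃ h12 h13 h23).elim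
      · exact (mix s₁ h13 g13 t₃).elim
    · exact (mix s₁ h12 g12 t₂).elim
  rcases c₂ with ⟨P₂, Q₂, s₂⟩ | t₂
  · exact (mix s₂ h12.symm ⟨y₃, hy₃, h23.symm, h13.symm⟩ t₁).elim
  rcases c₃ with ⟨P₃, Q₃, s₃⟩ | t₃
  · exact (mix s₃ h13.symm ⟨y₂, hy₂, h23, h12.symm⟩ t₁).elim
  -- `∅, {y₁}, {y₂}, {y₃}` are four colours
  have hsub : ({∅, {y₁}, {y₂}, {y₃}} : Finset (Finset α)) ⊆ monoMeets X Y := by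
    intro w hw
    simp only [mem_insert, mem_singleton] at hw
    rcases hw with rfl | rfl | rfl | rfl
    exacts [empty_mem_monoMeets X Y, sing t₁, sing t₂, sing t₃]
  have hcard : #({∅, {y₁}, {y₂}, {y₃}} : Finset (Finset α)) = 4 := by
    have n1 : ({y₁} : Finset α) ≠ {y₂} := fun e => h12 (singleton_injective e)
    have n2 : ({y₁} : Finset α) ≠ {y₃} := fun e => h13 (singleton_injective e)
    have n3 : ({y₂} : Finset α) ≠ {y₃} := fun e => h23 (singleton_injective e)
    rw [card_insert_of_notMem, card_insert_of_notMem, card_pair n3]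
    · simp only [mem_insert, mem_singleton, not_or]; exact ⟨n1, n2⟩
    · simp only [mem_insert, mem_singleton, not_or]
      exact ⟨(singleton_ne_empty y₁).symm, (singleton_ne_empty y₂).symm, (singleton_ne_empty y₃).symm⟩
  exact hcard ▸ card_le_card hsub

/-- **`#Z = 8 ⟹ 4 ≤ #monoMeets`**, on every ground set. [this work] -/
theorem four_le_card_monoMeets_eight : ∀ (n : ℕ) (G : Finset α), #G = n → ∀ (X Y : Finset (Finset α)),
    (∀ z ∈ X ∪ Y, z ⊆ G) → (∀ z ∈ X ∪ Y, G \ z ∈ X ∪ Y) → Disjoint X Y → #(X ∪ Y) = 8 → 4 ≤ #(monoMeets X Y) := by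
  intro n
  induction' n using Nat.strong_induction_on with n ih
  intro G hGn X Y hZG hcc hXY h8
  -- the ground set has at least three points
  have hG3 : 3 ≤ #G := by
    by_contra h
    push Not at h
    have := card_le_two_pow_card hZG
    have h2 : 2 ^ #G ≤ 2 ^ 2 := Nat.pow_le_pow_right (by norm_num) (by omega)
    omega
  by_cases hA : ∃ y ∈ G, #(bothLifts (X ∪ Y) y) = 0
  · -- project away a point without doubled members
    obtain ⟨y, hy, hD0⟩ := hA
    obtain ⟨hZ'G, hcc', hXY'⟩ := proj_config (y := y) hZG hcc
    have h8' : #((X.image fun s => s.erase y) ∪ ((Y.image fun s => s.erase y) \ X.image fun s => s.erase y)) = 8 := by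
      rw [proj_union]; have := card_image_erase_add_card_bothLifts (X ∪ Y) y; omega
    have := ih #(G.erase y) (by rw [← hGn]; exact card_erase_lt_of_mem hy) (G.erase y) rfl _ _ hZ'G hcc' hXY' h8'
    have := card_proj_add_twins_le X Y y
    omega
  push Not at hA
  have hsparse : ∀ y ∈ G, 0 < #(bothLifts (X ∪ Y) y) ∧ #(bothLifts (X ∪ Y) y) < 6 := by
    intro y hy
    have := two_mul_card_bothLifts_le (X ∪ Y) y
    have := hA y hy
    omega
  -- three points of `G`
  obtain ⟨y₁, hy₁⟩ : G.Nonempty := card_pos.1 (by omega)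
  obtain ⟨y₂, hy₂⟩ : (G.erase y₁).Nonempty := card_pos.1 (by rw [card_erase_of_mem hy₁]; omega)
  obtain ⟨h21, hy₂G⟩ := mem_erase.1 hy₂
  obtain ⟨y₃, hy₃⟩ : ((G.erase y₁).erase y₂).Nonempty :=
    card_pos.1 (by rw [card_erase_of_mem hy₂, card_erase_of_mem hy₁]; omega)
  obtain ⟨h32, hy₃'⟩ := mem_erase.1 hy₃
  obtain ⟨h31, hy₃G⟩ := mem_erase.1 hy₃'
  -- a twin point among them finishes; otherwise all three are deficit
  by_cases htp : ∃ y ∈ ({y₁, y₂, y₃} : Finset α), #(bothLifts (X ∪ Y) y) ≤ 2 * #(bothLifts (monoMeets X Y) y)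
  · obtain ⟨y, hy, htw⟩ := htp
    have hyG : y ∈ G := by
      simp only [mem_insert, mem_singleton] at hy
      rcases hy with rfl | rfl | rfl <;> assumption
    obtain ⟨hpos, -⟩ := hsparse y hyG
    have hGe : (G.erase y).Nonempty := by
      rw [← card_pos, card_erase_of_mem hyG]; omega
    obtain ⟨U, hU⟩ := even_card_bothLifts hyG hZG hcc hXY hGe
    have hle := two_mul_card_bothLifts_le (X ∪ Y) y
    by_cases h2 : #(bothLifts (X ∪ Y) y) = 2
    · -- six members after projection
      obtain ⟨hZ'G, hcc', hXY'⟩ := proj_config (y := y) hZG hcc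
      have h6' : #((X.image fun s => s.erase y) ∪ ((Y.image fun s => s.erase y) \ X.image fun s => s.erase y)) = 6 := by
        rw [proj_union]; have := card_image_erase_add_card_bothLifts (X ∪ Y) y; omega
      have h3 := three_le_card_monoMeets_six hZ'G hcc' hXY' h6'
      have := card_proj_add_twins_le X Y y
      omega
    · -- `#D_y = 4`: two twins
      have h4 : #(bothLifts (X ∪ Y) y) = 4 := by omega
      have := two_mul_card_twins_le X Y y
      omega
  · push Not at htp
    refine four_le_of_three_deficit hXY hZG hcc hy₁ hy₂G hy₃G h21.symm h31.symm h32.symm ?_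
    intro y hy
    have hyG : y ∈ G := by
      simp only [mem_insert, mem_singleton] at hy
      rcases hy with rfl | rfl | rfl <;> assumption
    exact ⟨(hsparse y hyG).1, (hsparse y hyG).2, htp y hy⟩

/-- **THEOREM (`SmallTwoColourMeets`).**  The two-colouring inequality for three or four antipodal pairs. [this work] -/
theorem smallTwoColourMeets : SmallTwoColourMeets α := by
  intro G X Y hZG hcc hXY h6 h10
  -- `#Z` is even
  have hGne : G.Nonempty := by
    rw [nonempty_iff_ne_empty]; rintro rfl
    have hsub : X ∪ Y ⊆ {∅} := fun z hz => mem_singleton.2 (subset_empty.1 (hZG z hz))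
    have := card_le_card hsub
    rw [card_singleton] at this; omega
  obtain ⟨U, hU, hUcf, hZ⟩ := exists_half_of_closed hGne (X ∪ Y) hZG hcc
  have hev : #(X ∪ Y) = 2 * #U := by
    rw [hZ]; exact card_union_image_sdiff (fun u hu => hZG u (hU hu)) hUcf
  by_cases h6' : #(X ∪ Y) = 6
  · exact card_le_two_mul_card_monoMeets_six hZG hcc hXY h6'
  · have h8 : #(X ∪ Y) = 8 := by omega
    have := four_le_card_monoMeets_eight #G G rfl X Y hZG hcc hXY h8
    omega

end Small4

/-! ### The unconditional theorems -/

/-- **THEOREM (`TwoColourMeets`, gen 40/41's M3♯).**  For every complement-closed `Z = X ⊔ Y ⊆ 2^G` with `#Z ≥ 6`: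
`#Z ≤ 2 · #monoMeets X Y`. [this work] -/
theorem twoColourMeets : TwoColourMeets α := twoColourMeets_of_small smallTwoColourMeets

/-- **THEOREM (`ThreeFamilyTwin`, the three-family twin inequality M3♯ of gen 40).** [this work] -/
theorem threeFamilyTwin : ThreeFamilyTwin α := threeFamilyTwin_of_twoColourMeets twoColourMeets

/-- **THEOREM (`RainbowStrict`, the strict rainbow lemma of gen 40).** [this work] -/
theorem rainbowStrict : RainbowStrict α := rainbowStrict_of_small smallTwoColourMeets

/-- **THEOREM — THE RAINBOW LEMMA (`RainbowMeetCojoin`, conjectured gen 33).**  A complement-free family `𝒜` of subsets of `G`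
has at least `#𝒜` distinct sets among `∅`, the meets `a ∩ b` and the complemented joins `G ∖ (a ∪ b)` of its distinct members.
[this work] -/
theorem rainbowMeetCojoin : RainbowMeetCojoin α := rainbowMeetCojoin_of_small smallTwoColourMeets


/-- `SparseTwoColourMeets` (gen 41's typed residual) holds. [this work] -/
theorem sparseTwoColourMeets : SparseTwoColourMeets α :=
  sparseTwoColourMeets_of_twinPoint sparseTwinPoint smallTwoColourMeets

/-- `PinnedResidual` (gen 40's typed residual) holds: its conclusion is the rainbow lemma. [this work] -/
theorem pinnedResidual : PinnedResidual α := fun F 𝒜 h𝒜F hcf _ _ _ => rainbowMeetCojoin F 𝒜 h𝒜F hcf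

/-- `PinnedResidualMixed` (gen 40) holds. [this work] -/
theorem pinnedResidualMixed : PinnedResidualMixed α := fun F 𝒜 h𝒜F hcf _ _ _ _ => rainbowMeetCojoin F 𝒜 h𝒜F hcf

/-- `PinnedResidualCore` (gen 40) holds. [this work] -/
theorem pinnedResidualCore : PinnedResidualCore α := fun F 𝒜 h𝒜F hcf _ _ _ _ _ _ => rainbowMeetCojoin F 𝒜 h𝒜F hcf

end Summit.CriticalPhenomena.PercolationContinuityZ3.Theorems.SahiColouredDaykin
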